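import Mathlib

/-!
# Counting strictly upper-triangular positions

The strictly upper-triangular positions `(i, j)` with `i < j` of an `n × n` grid — the free
entries of a unipotent upper-triangular matrix — number `n (n - 1) / 2` (natural-number
division is exact here since `n (n - 1)` is even).

The proof re-indexes the pairs `(i, j)` with `i < j` as the sigma type `Σ j : Fin n, Fin j`
(column `j`, then row `i < j`) and sums `∑ j < n, j = n (n - 1) / 2` (`Finset.sum_range_id`).
-/

set_option linter.dupNamespace false

namespace Summit.MatrixMultiplication.MatrixMultiplication.Theorems.BorderHalfDimensionDesigns

/-- The strictly upper-triangular positions `(i, j)`, `i < j`, of an `n × n` grid number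
`n (n - 1) / 2`. -/
theorem stub_card_strictUpper (n : ℕ) :
    Fintype.card {p : Fin n × Fin n // p.1 < p.2} = n * (n - 1) / 2 := by
  -- re-index by the column `j` and the row `i < j`
  have e : {p : Fin n × Fin n // p.1 < p.2} ≃ Σ j : Fin n, Fin (j : ℕ) :=
    { toFun := fun p => ⟨p.1.2, ⟨(p.1.1 : ℕ), p.2⟩⟩
      invFun := fun q => ⟨(⟨(q.2 : ℕ), lt_trans q.2.2 q.1.2⟩, q.1), q.2.2⟩
      left_inv := fun _ => rfl
      right_inv := fun _ => rfl }
  rw [Fintype.card_congr e, Fintype.card_sigma]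
  simp only [Fintype.card_fin]
  rw [Fin.sum_univ_eq_sum_range (fun i => i) n, Finset.sum_range_id]

end Summit.MatrixMultiplication.MatrixMultiplication.Theorems.BorderHalfDimensionDesigns
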